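import Summits.Ventures.CertifiedManyBodySolver.Downfold.EmeryFermiScalePoint
import Mathlib.Analysis.SpecialFunctions.Trigonometric.Deriv
import HarnessLib

/-!
# The NODAL VELOCITY of the σ three-band (Emery) model, exactly: the squared k-gradient of the energy-linearised band at
# the zone-diagonal Fermi point in closed form, a sqrt-free node bracket, and a kernel-checkable window

Venture CertifiedManyBodySolver, cell `pub/hubbard-downfold` (stage S1), seat hubbard-downfold-mod-4 (technique B); namespace
`Summit.Ventures.CertifiedManyBodySolver.Downfold.Emery`. Everything here is PROVED. WHAT THIS IS NOT: a statement about any material;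
no number lives here; `U = 0` band kinematics; velocities are those of the ENERGY-LINEARISED band (`EmeryFermiSurfaceShapeBox` §2:
`ε(k) − ε₀ ≈ −charCubic(k, ε₀)/∂_ε charCubic(k, ε₀)`, exact Taylor identity `charCubic_taylor`), in units `eV · a/ħ`.

* §1 THE k-GRADIENT. In `x = sin²(kx/2)`, `y = sin²(ky/2)`: `∂charCubic/∂x = −(4fsD + 16fsN·y)` (`hasDerivAt_charCubic_x`) and
  `d/dk sin²(k/2) = sin(k/2)cos(k/2)` with `(sin(k/2)cos(k/2))² = x(1 − x)` (`hasDerivAt_halfSq'`, `sin_half_mul_cos_half_sq`); hence at a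
  DIAGONAL point `x = y` the squared k-gradient of the linearised band is `nodalVel2 = 2(4fsD + 16fsN·x)²·x(1 − x)/(∂_ε charCubic)²`
  (`nodalVel2`; the factor 2 = two equal Cartesian components).
* §2 THE NODE. On the contour the diagonal point satisfies `(4fsN·x + fsD)² = fsK` (`node_hyperbola`); a rational bracket `[x₁, x₂]` with
  `(4fsN·x₁ + fsD)² ≤ fsK ≤ (4fsN·x₂ + fsD)²` encloses it WITHOUT square roots (`node_mem_Icc`).
* §3 `nodeCheck` / `nodeCheckPieces` — rational interval arithmetic (images of `EmeryFermiVelocityScaleIntervals`) deciding the node bracket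
  and a window `[lo, hi] ∋ nodalVel2` on a parameter sub-box × energy piece; soundness `nodalVel2_mem_of_nodeCheck(Pieces)`; composed with the
  point Fermi-energy bracket: `pointNodal_of_checks`.

Consumer: the census files `EmeryFermiNodalPoints*` (certified: the bare nodal velocity of a printed σ set is RIGID under doping while its
one-band scale is not). Sources: [HybertsenSchluterChristensen1989, Eq. (1)]; [AndersenEtAl1995, §6]; interval arithmetic [folklore] (Moore 1966).
-/

noncomputable section

namespace Summit.Ventures.CertifiedManyBodySolver.Downfold.Emery

open Real Set NonemptyInterval

/-! ## §1 The k-gradient of the secular cubic -/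

/-- `∂charCubic/∂x = −(4fsD + 16fsN·y)` (the cubic is bilinear in `(x, y)`). [folklore] -/
theorem hasDerivAt_charCubic_x (Δ tpd tpp c y ε x : ℝ) :
    HasDerivAt (fun x' => charCubic Δ tpd tpp c x' y ε) (-(4 * fsD Δ tpd c ε + 16 * fsN tpd tpp c ε * y)) x := by
  have h : (fun x' => charCubic Δ tpd tpp c x' y ε) =
      fun x' => (cA Δ ε - 4 * fsD Δ tpd c ε * y) + (-(4 * fsD Δ tpd c ε + 16 * fsN tpd tpp c ε * y)) * x' := by
    funext x'; rw [charCubic_bilinear]; ring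
  rw [h]
  have := ((hasDerivAt_id' x).const_mul (-(4 * fsD Δ tpd c ε + 16 * fsN tpd tpp c ε * y))).const_add
    (cA Δ ε - 4 * fsD Δ tpd c ε * y)
  exact this.congr_deriv (by ring)

/-- `d/dk sin²(k/2) = sin(k/2)·cos(k/2)`. [folklore] -/
theorem hasDerivAt_halfSq' (k : ℝ) :
    HasDerivAt (fun k' => Real.sin (k' / 2) ^ 2) (Real.sin (k / 2) * Real.cos (k / 2)) k := by
  have h1 : HasDerivAt (fun k' : ℝ => k' / 2) (1 / 2) k := (hasDerivAt_id' k).div_const 2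
  have h2 : HasDerivAt (fun k' : ℝ => Real.sin (k' / 2)) (Real.cos (k / 2) * (1 / 2)) k := by
    have := (Real.hasDerivAt_sin (k / 2)).comp k h1
    simpa [Function.comp_def] using this
  have h3 := h2.pow 2
  refine h3.congr_deriv ?_
  push_cast
  ring

/-- `(sin(k/2)cos(k/2))² = x(1 − x)` with `x = sin²(k/2)`. [folklore] -/
theorem sin_half_mul_cos_half_sq (k : ℝ) :
    (Real.sin (k / 2) * Real.cos (k / 2)) ^ 2 = Real.sin (k / 2) ^ 2 * (1 - Real.sin (k / 2) ^ 2) := by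
  rw [mul_pow, Real.cos_sq']

/-- CHAIN RULE along `k_x` at fixed `k_y`: the `k_x`-derivative of the secular cubic at `(x, y) = (sin²(kx/2), sin²(ky/2))` is
`−(4fsD + 16fsN·y)·sin(kx/2)cos(kx/2)`; its square is `(4fsD + 16fsN·y)²·x(1 − x)`. [folklore] -/
theorem hasDerivAt_charCubic_kx (Δ tpd tpp c ky ε kx : ℝ) :
    HasDerivAt (fun k => charCubic Δ tpd tpp c (Real.sin (k / 2) ^ 2) (Real.sin (ky / 2) ^ 2) ε)
      (-(4 * fsD Δ tpd c ε + 16 * fsN tpd tpp c ε * Real.sin (ky / 2) ^ 2) * (Real.sin (kx / 2) * Real.cos (kx / 2))) kx := by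
  have := (hasDerivAt_charCubic_x Δ tpd tpp c (Real.sin (ky / 2) ^ 2) ε (Real.sin (kx / 2) ^ 2)).comp kx (hasDerivAt_halfSq' kx)
  simpa [Function.comp_def] using this

/-- **Squared nodal velocity of the energy-linearised band** at a DIAGONAL point `x = y` of the `ε`-contour (units `(eV·a/ħ)²`):
`|∇_k ε_lin|² = |∇_k charCubic|²/(∂_ε charCubic)² = 2·(4fsD + 16fsN·x)²·x(1 − x)/(∂_ε charCubic(x, x))²` — two equal Cartesian components by
`hasDerivAt_charCubic_kx` and `sin_half_mul_cos_half_sq`. [cite: AndersenEtAl1995, §6 (energy-linearised downfolding)] -/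
def nodalVel2 (Δ tpd tpp c x ε : ℝ) : ℝ :=
  2 * (4 * fsD Δ tpd c ε + 16 * fsN tpd tpp c ε * x) ^ 2 * (x * (1 - x)) / dcharCubic Δ tpd tpp c x x ε ^ 2

/-! ## §2 The node without square roots -/

/-- On the contour, the diagonal point satisfies `(4fsN·x + fsD)² = fsK`. [folklore] -/
theorem node_hyperbola {Δ tpd tpp c x ε : ℝ} (hP : charCubic Δ tpd tpp c x x ε = 0) :
    (4 * fsN tpd tpp c ε * x + fsD Δ tpd c ε) ^ 2 = fsK Δ tpd tpp c ε := by
  rw [sq]; exact contour_hyperbola hP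

/-- SQRT-FREE NODE BRACKET: `x, x₁, x₂ ≥ 0`, `fsN, fsD > 0`, `(4fsN·x₁ + fsD)² ≤ fsK ≤ (4fsN·x₂ + fsD)²` ⇒ the diagonal contour point
lies in `[x₁, x₂]`. [folklore] -/
theorem node_mem_Icc {Δ tpd tpp c x ε x₁ x₂ : ℝ} (hN : 0 < fsN tpd tpp c ε) (hD : 0 < fsD Δ tpd c ε) (hx : 0 ≤ x)
    (hx₁ : 0 ≤ x₁) (hx₂ : 0 ≤ x₂) (hP : charCubic Δ tpd tpp c x x ε = 0)
    (h₁ : (4 * fsN tpd tpp c ε * x₁ + fsD Δ tpd c ε) ^ 2 ≤ fsK Δ tpd tpp c ε)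
    (h₂ : fsK Δ tpd tpp c ε ≤ (4 * fsN tpd tpp c ε * x₂ + fsD Δ tpd c ε) ^ 2) : x ∈ Set.Icc x₁ x₂ := by
  rw [← node_hyperbola hP] at h₁ h₂
  have hu : 0 ≤ 4 * fsN tpd tpp c ε * x + fsD Δ tpd c ε := by positivity
  have hu₁ : 0 ≤ 4 * fsN tpd tpp c ε * x₁ + fsD Δ tpd c ε := by positivity
  have hu₂ : 0 ≤ 4 * fsN tpd tpp c ε * x₂ + fsD Δ tpd c ε := by positivity
  have e₁ := (pow_le_pow_iff_left₀ hu₁ hu two_ne_zero).1 h₁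
  have e₂ := (pow_le_pow_iff_left₀ hu hu₂ two_ne_zero).1 h₂
  constructor
  · nlinarith
  · nlinarith

/-! ## §3 The kernel-decidable node/velocity check -/

/-- Interval image of `∂_ε charCubic(x, x) = cA′ − 4fsD′·(x + x) − 16fsN′·(x·x)` at a diagonal point `x ∈ Ix` (parse-matched).
[folklore] -/
def idcharDiag (IΔ Ia Ib Ic Ie Ix : NonemptyInterval ℚ) : NonemptyInterval ℚ :=
  idcA IΔ Ie - (iscale 4 (idfsD IΔ Ia Ic Ie)).mooreMul (Ix + Ix) - (iscale 16 (idfsN Ib Ic)).mooreMul (Ix.mooreMul Ix)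

/-- Interval image of the numerator `2·(4fsD + 16fsN·x)²·(x(1 − x))` (parse-matched). [folklore] -/
def inodalNum (IΔ Ia Ib Ic Ie Ix : NonemptyInterval ℚ) : NonemptyInterval ℚ :=
  (iscale 2 ((iscale 4 (ifsD IΔ Ia Ic Ie) + (iscale 16 (ifsN Ia Ib Ic Ie)).mooreMul Ix).moorePow 2)).mooreMul
    (Ix.mooreMul (NonemptyInterval.pure 1 - Ix))

/-- **`nodeCheck`** — on a parameter sub-box × energy piece: signs, the sqrt-free NODE BRACKET `[x₁, x₂]` (conservative AM tests
`(4·sup fsN·x₁ + sup fsD)² ≤ inf fsN·inf cA + (inf fsD)²` and `sup fsN·sup cA + (sup fsD)² ≤ (4·inf fsN·x₂ + inf fsD)²`), a positive diagonal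
energy denominator, and the window `[lo, hi] ∋ nodalVel2`. [folklore] -/
def nodeCheck (Δ₁ Δ₂ a₁ a₂ b₁ b₂ c₁ c₂ e₁ e₂ x₁ x₂ lo hi : ℚ) : Bool :=
  let IΔ := ihull Δ₁ Δ₂
  let Ia := ihull a₁ a₂
  let Ib := ihull b₁ b₂
  let Ic := ihull c₁ c₂
  let Ie := ihull e₁ e₂
  let Ix := ihull x₁ x₂
  decide (0 ≤ min e₁ e₂) && decide (0 ≤ x₁) && decide (x₁ ≤ x₂) &&
  decide (0 < (ifsN Ia Ib Ic Ie).fst) && decide (0 < (ifsD IΔ Ia Ic Ie).fst) && decide (0 ≤ (icA IΔ Ie).fst) &&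
  decide ((4 * (ifsN Ia Ib Ic Ie).snd * x₁ + (ifsD IΔ Ia Ic Ie).snd) ^ 2 ≤
    (ifsN Ia Ib Ic Ie).fst * (icA IΔ Ie).fst + (ifsD IΔ Ia Ic Ie).fst ^ 2) &&
  decide ((ifsN Ia Ib Ic Ie).snd * (icA IΔ Ie).snd + (ifsD IΔ Ia Ic Ie).snd ^ 2 ≤
    (4 * (ifsN Ia Ib Ic Ie).fst * x₂ + (ifsD IΔ Ia Ic Ie).fst) ^ 2) &&
  decide (0 < (idcharDiag IΔ Ia Ib Ic Ie Ix).fst) && decide (0 < ((idcharDiag IΔ Ia Ib Ic Ie Ix).moorePow 2).fst) &&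
  decide (lo ≤ (idivPos (inodalNum IΔ Ia Ib Ic Ie Ix) ((idcharDiag IΔ Ia Ib Ic Ie Ix).moorePow 2)).fst) &&
  decide ((idivPos (inodalNum IΔ Ia Ib Ic Ie Ix) ((idcharDiag IΔ Ia Ib Ic Ie Ix).moorePow 2)).snd ≤ hi)

/-- **Soundness of `nodeCheck`**: at the diagonal contour point (`charCubic(x, x, ε) = 0`, `0 ≤ x ≤ 1`) of any parameter point of the
sub-box and energy of the piece: the node lies in `[x₁, x₂]`, the energy denominator is positive and `nodalVel2 ∈ [lo, hi]`. [folklore] -/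
theorem nodalVel2_mem_of_nodeCheck {Δ₁ Δ₂ a₁ a₂ b₁ b₂ c₁ c₂ e₁ e₂ x₁ x₂ lo hi : ℚ}
    (h : nodeCheck Δ₁ Δ₂ a₁ a₂ b₁ b₂ c₁ c₂ e₁ e₂ x₁ x₂ lo hi = true)
    {Δ tpd tpp c ε x : ℝ} (hΔ : Δ ∈ Set.Icc (Δ₁ : ℝ) Δ₂) (ha : tpd ∈ Set.Icc (a₁ : ℝ) a₂)
    (hb : tpp ∈ Set.Icc (b₁ : ℝ) b₂) (hc : c ∈ Set.Icc (c₁ : ℝ) c₂) (he : ε ∈ Set.Icc (e₁ : ℝ) e₂)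
    (hx : x ∈ Set.Icc (0 : ℝ) 1) (hP : charCubic Δ tpd tpp c x x ε = 0) :
    x ∈ Set.Icc (x₁ : ℝ) x₂ ∧ 0 < dcharCubic Δ tpd tpp c x x ε ∧ nodalVel2 Δ tpd tpp c x ε ∈ Set.Icc (lo : ℝ) hi := by
  simp only [nodeCheck, Bool.and_eq_true, decide_eq_true_eq] at h
  obtain ⟨⟨⟨⟨⟨⟨⟨⟨⟨⟨⟨-, hx₁⟩, hx₁₂⟩, hNq⟩, hDq⟩, hAq⟩, hK₁⟩, hK₂⟩, hdq⟩, hd2q⟩, hlo⟩, hhi⟩ := h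
  obtain ⟨mcA, mD, mN, -, mdcA, mdD, mdN⟩ := mem_images hΔ ha hb hc he
  have hN : 0 < fsN tpd tpp c ε := lt_of_lt_of_le (by exact_mod_cast hNq) (mem_ratCast_iff.mp mN).1
  have hD : 0 < fsD Δ tpd c ε := lt_of_lt_of_le (by exact_mod_cast hDq) (mem_ratCast_iff.mp mD).1
  have rN := mem_ratCast_iff.mp mN
  have rD := mem_ratCast_iff.mp mD
  have rA := mem_ratCast_iff.mp mcA
  have hx₁' : (0 : ℝ) ≤ x₁ := by exact_mod_cast hx₁
  have hx₂' : (0 : ℝ) ≤ x₂ := by have : (x₁ : ℝ) ≤ x₂ := by exact_mod_cast hx₁₂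
                                 linarith
  have hA0 : (0 : ℝ) ≤ ((icA (ihull Δ₁ Δ₂) (ihull e₁ e₂)).fst : ℝ) := by exact_mod_cast hAq
  -- lower node test ⇒ (4N x₁ + D)² ≤ fsK
  have h₁ : (4 * fsN tpd tpp c ε * x₁ + fsD Δ tpd c ε) ^ 2 ≤ fsK Δ tpd tpp c ε := by
    have hup : 4 * fsN tpd tpp c ε * x₁ + fsD Δ tpd c ε ≤
        4 * ((ifsN (ihull a₁ a₂) (ihull b₁ b₂) (ihull c₁ c₂) (ihull e₁ e₂)).snd : ℝ) * x₁ +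
          ((ifsD (ihull Δ₁ Δ₂) (ihull a₁ a₂) (ihull c₁ c₂) (ihull e₁ e₂)).snd : ℝ) := by nlinarith [rN.2, rD.2]
    have hsq := pow_le_pow_left₀ (by positivity) hup 2
    have hK₁' := hK₁
    have hcast : ((4 * (ifsN (ihull a₁ a₂) (ihull b₁ b₂) (ihull c₁ c₂) (ihull e₁ e₂)).snd * x₁ +
        (ifsD (ihull Δ₁ Δ₂) (ihull a₁ a₂) (ihull c₁ c₂) (ihull e₁ e₂)).snd) ^ 2 : ℚ) ≤
        ((ifsN (ihull a₁ a₂) (ihull b₁ b₂) (ihull c₁ c₂) (ihull e₁ e₂)).fst * (icA (ihull Δ₁ Δ₂) (ihull e₁ e₂)).fst +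
        (ifsD (ihull Δ₁ Δ₂) (ihull a₁ a₂) (ihull c₁ c₂) (ihull e₁ e₂)).fst ^ 2 : ℚ) := hK₁'
    have hcastR := (Rat.cast_le (K := ℝ)).2 hcast
    push_cast at hcastR
    have hKlo : ((ifsN (ihull a₁ a₂) (ihull b₁ b₂) (ihull c₁ c₂) (ihull e₁ e₂)).fst : ℝ) *
        ((icA (ihull Δ₁ Δ₂) (ihull e₁ e₂)).fst : ℝ) +
        ((ifsD (ihull Δ₁ Δ₂) (ihull a₁ a₂) (ihull c₁ c₂) (ihull e₁ e₂)).fst : ℝ) ^ 2 ≤ fsK Δ tpd tpp c ε := by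
      unfold fsK
      have h1 := mul_le_mul rN.1 rA.1 hA0 hN.le
      have hDq' : (0 : ℝ) < ((ifsD (ihull Δ₁ Δ₂) (ihull a₁ a₂) (ihull c₁ c₂) (ihull e₁ e₂)).fst : ℝ) := by exact_mod_cast hDq
      have h2 := pow_le_pow_left₀ hDq'.le rD.1 2
      linarith
    linarith
  -- upper node test ⇒ fsK ≤ (4N x₂ + D)²
  have h₂ : fsK Δ tpd tpp c ε ≤ (4 * fsN tpd tpp c ε * x₂ + fsD Δ tpd c ε) ^ 2 := by
    have hNq' : (0 : ℝ) < ((ifsN (ihull a₁ a₂) (ihull b₁ b₂) (ihull c₁ c₂) (ihull e₁ e₂)).fst : ℝ) := by exact_mod_cast hNq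
    have hDq' : (0 : ℝ) < ((ifsD (ihull Δ₁ Δ₂) (ihull a₁ a₂) (ihull c₁ c₂) (ihull e₁ e₂)).fst : ℝ) := by exact_mod_cast hDq
    have hlow : 4 * ((ifsN (ihull a₁ a₂) (ihull b₁ b₂) (ihull c₁ c₂) (ihull e₁ e₂)).fst : ℝ) * x₂ +
        ((ifsD (ihull Δ₁ Δ₂) (ihull a₁ a₂) (ihull c₁ c₂) (ihull e₁ e₂)).fst : ℝ) ≤
          4 * fsN tpd tpp c ε * x₂ + fsD Δ tpd c ε := by nlinarith [rN.1, rD.1]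
    have hsq := pow_le_pow_left₀ (by positivity) hlow 2
    have hcastR := (Rat.cast_le (K := ℝ)).2 hK₂
    push_cast at hcastR
    have hKhi : fsK Δ tpd tpp c ε ≤ ((ifsN (ihull a₁ a₂) (ihull b₁ b₂) (ihull c₁ c₂) (ihull e₁ e₂)).snd : ℝ) *
        ((icA (ihull Δ₁ Δ₂) (ihull e₁ e₂)).snd : ℝ) +
        ((ifsD (ihull Δ₁ Δ₂) (ihull a₁ a₂) (ihull c₁ c₂) (ihull e₁ e₂)).snd : ℝ) ^ 2 := by
      unfold fsK
      have h1 := mul_le_mul rN.2 rA.2 (hA0.trans rA.1) (hN.le.trans rN.2)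
      have h2 := pow_le_pow_left₀ hD.le rD.2 2
      linarith
    linarith
  have hxI := node_mem_Icc hN hD hx.1 hx₁' hx₂' hP h₁ h₂
  have mx := mem_ihull hxI
  -- the diagonal denominator
  have m4 : (4 : ℝ) ∈ (NonemptyInterval.pure (4 : ℚ)).ratCast ℝ := mem_pure_of_cast_eq (by norm_num)
  have md : dcharCubic Δ tpd tpp c x x ε ∈
      (idcharDiag (ihull Δ₁ Δ₂) (ihull a₁ a₂) (ihull b₁ b₂) (ihull c₁ c₂) (ihull e₁ e₂) (ihull x₁ x₂)).ratCast ℝ := by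
    unfold dcharCubic idcharDiag
    have m4D := mem_iscale 4 mdD
    have m16N := mem_iscale 16 mdN
    push_cast at m4D m16N
    exact mem_ratCast_sub (mem_ratCast_sub mdcA (mem_ratCast_mul m4D (mem_ratCast_add mx mx)))
      (mem_ratCast_mul m16N (mem_ratCast_mul mx mx))
  have hd : 0 < dcharCubic Δ tpd tpp c x x ε := lt_of_lt_of_le (by exact_mod_cast hdq) (mem_ratCast_iff.mp md).1
  -- the numerator and the quotient
  have m1 : (1 : ℝ) ∈ (NonemptyInterval.pure (1 : ℚ)).ratCast ℝ := mem_pure_of_cast_eq (by norm_num)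
  have mnum : 2 * (4 * fsD Δ tpd c ε + 16 * fsN tpd tpp c ε * x) ^ 2 * (x * (1 - x)) ∈
      (inodalNum (ihull Δ₁ Δ₂) (ihull a₁ a₂) (ihull b₁ b₂) (ihull c₁ c₂) (ihull e₁ e₂) (ihull x₁ x₂)).ratCast ℝ := by
    unfold inodalNum
    have m4D := mem_iscale 4 mD
    have m16N := mem_iscale 16 mN
    push_cast at m4D m16N
    have msq := mem_ratCast_sq (mem_ratCast_add m4D (mem_ratCast_mul m16N mx))
    have m2sq := mem_iscale 2 msq
    push_cast at m2sq
    exact mem_ratCast_mul m2sq (mem_ratCast_mul mx (mem_ratCast_sub m1 mx))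
  have mv : nodalVel2 Δ tpd tpp c x ε ∈ (idivPos
      (inodalNum (ihull Δ₁ Δ₂) (ihull a₁ a₂) (ihull b₁ b₂) (ihull c₁ c₂) (ihull e₁ e₂) (ihull x₁ x₂))
      ((idcharDiag (ihull Δ₁ Δ₂) (ihull a₁ a₂) (ihull b₁ b₂) (ihull c₁ c₂) (ihull e₁ e₂) (ihull x₁ x₂)).moorePow 2)).ratCast ℝ := by
    unfold nodalVel2
    exact mem_idivPos hd2q mnum (mem_ratCast_sq md)
  rw [mem_ratCast_iff] at mv
  exact ⟨hxI, hd, le_trans (by exact_mod_cast hlo) mv.1, mv.2.trans (by exact_mod_cast hhi)⟩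

/-- `nodeCheck` on each of `m` uniform energy pieces of `[e_a, e_b]`, against the same bracket and window. [folklore] -/
def nodeCheckPieces (Δ₁ Δ₂ a₁ a₂ b₁ b₂ c₁ c₂ ea eb : ℚ) (m : ℕ) (x₁ x₂ lo hi : ℚ) : Bool :=
  decide (0 < m) && decide (ea ≤ eb) &&
  (List.range m).all fun j => nodeCheck Δ₁ Δ₂ a₁ a₂ b₁ b₂ c₁ c₂ (piecePt ea eb m j) (piecePt ea eb m (j + 1)) x₁ x₂ lo hi

/-- **Soundness of `nodeCheckPieces`**. [folklore] -/
theorem nodalVel2_mem_of_nodeCheckPieces {Δ₁ Δ₂ a₁ a₂ b₁ b₂ c₁ c₂ ea eb x₁ x₂ lo hi : ℚ} {m : ℕ}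
    (h : nodeCheckPieces Δ₁ Δ₂ a₁ a₂ b₁ b₂ c₁ c₂ ea eb m x₁ x₂ lo hi = true)
    {Δ tpd tpp c ε x : ℝ} (hΔ : Δ ∈ Set.Icc (Δ₁ : ℝ) Δ₂) (ha : tpd ∈ Set.Icc (a₁ : ℝ) a₂)
    (hb : tpp ∈ Set.Icc (b₁ : ℝ) b₂) (hc : c ∈ Set.Icc (c₁ : ℝ) c₂) (he : ε ∈ Set.Icc (ea : ℝ) eb)
    (hx : x ∈ Set.Icc (0 : ℝ) 1) (hP : charCubic Δ tpd tpp c x x ε = 0) :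
    x ∈ Set.Icc (x₁ : ℝ) x₂ ∧ 0 < dcharCubic Δ tpd tpp c x x ε ∧ nodalVel2 Δ tpd tpp c x ε ∈ Set.Icc (lo : ℝ) hi := by
  simp only [nodeCheckPieces, Bool.and_eq_true, decide_eq_true_eq, List.all_eq_true, List.mem_range] at h
  obtain ⟨⟨hm, hab⟩, hall⟩ := h
  obtain ⟨j, hj, hj1, hj2⟩ := exists_pieceIndex hm hab he
  exact nodalVel2_mem_of_nodeCheck (hall j hj) hΔ ha hb hc ⟨hj1, hj2⟩ hx hP

/-- **THE POINT NODAL THEOREM**: a printed one-body set, a filling window with its certified Fermi-energy bracket (`pointBracketCheck`) and a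
passing `nodeCheckPieces` on the degenerate box give: for every `ε` with `abFilling(ε) ∈ [ν₁, ν₂]` and its zone-diagonal Fermi point `x`:
`ε ∈ [e₁, e₂]`, the node `x ∈ [x₁, x₂]`, a positive denominator and `nodalVel2 ∈ [lo, hi]`. [folklore] -/
theorem pointNodal_of_checks {Δ a b c e₁ e₂ ν₁ ν₂ x₁ x₂ lo hi : ℚ} {jout jin : List ℕ} {m : ℕ}
    (hbr : pointBracketCheck Δ a b c e₁ e₂ ν₁ ν₂ jout jin = true)
    (hnc : nodeCheckPieces Δ Δ a a b b c c e₁ e₂ m x₁ x₂ lo hi = true)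
    {ε x : ℝ} (hν : abFilling Δ a b c ε ∈ Set.Icc (ν₁ : ℝ) ν₂)
    (hx : x ∈ Set.Icc (0 : ℝ) 1) (hP : charCubic Δ a b c x x ε = 0) :
    ε ∈ Set.Icc (e₁ : ℝ) e₂ ∧ x ∈ Set.Icc (x₁ : ℝ) x₂ ∧ 0 < dcharCubic Δ a b c x x ε ∧
      nodalVel2 Δ a b c x ε ∈ Set.Icc (lo : ℝ) hi := by
  have hε := fermiEnergy_mem_Icc_of_pointBracketCheck hbr hν
  exact ⟨hε, nodalVel2_mem_of_nodeCheckPieces hnc ⟨le_rfl, le_rfl⟩ ⟨le_rfl, le_rfl⟩ ⟨le_rfl, le_rfl⟩ ⟨le_rfl, le_rfl⟩ hε hx hP⟩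

end Summit.Ventures.CertifiedManyBodySolver.Downfold.Emery
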